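import Literature.MathematicalPhysics.QuantumFieldTheory.Balaban1983to89.Node00.TorusCoverGaugeTokens152153BoxFiner
import Literature.MathematicalPhysics.QuantumFieldTheory.Balaban1983to89.Node00.TorusCoverCollarOfMeetsPrintBox

/-!
# NODE 00 — THE FAMILIES-LEVEL (152)+(153) DOOR OF [Balaban1985Variational], UNIFORM IN THE RECORD'S BASIC CUBE SIZE, AT A BOX-FORM DATUM: generation 6's
# `gauge152_REfiner153_box_of_within_of_prop6P_uniform` with the `Within`-witness taken in the PRINT BOX `box L (cornerP M₀ ρ a) (sideP M₀ ρ) n` (the window's own index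
# set) instead of the grid cube `cubeExt (side L M₀ n) a 0` — the meeting premise of dag-n07-e's clean clause (`…N07SplitClauseLevelRaising.datumGaugeSplitTopStepCoreG_of_clean`)

Cell `pub-ymgap`, width seat `pub-ymgap-dag-n07-w3` generation 7, CLAIM-3 ∕ INTENT-3 (A) (cell INBOX 2026-08-28; trigger (t3) named by dag-n07-e g22's CLAIM-57a).  NEW leaf — a SIBLING
of generation 6's `Node00.TorusCoverGaugeTokens152153BoxUniform` (p626788), deliberately NOT an edition of it (an edition would re-elaborate the S6 head's whole import chain over that
file); PROOF kind (no `def`, no `instance`, no `notation`).  CONSUMED BY NAME, nothing modified: generation 5's `Node00.TorusCoverLandau153REFiner`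
(`exists_localGauge152_REfiner153_coverBox_propCubeP_of_prop6P`), dag-n07-e's module 57a `Node00.TorusCoverCollarOfMeetsPrintBox` (`Sect2.hcollar_cubeIdxP'_of_within_mem_box` —
the collar clause from a BOX point within `Dw` of `Ω_n`, SAME floor as dag-n07-w4's core form), FILE P3 `Node00.TorusCoverGaugeTokensRPrint` (`b9OfP`, `a0OfP`, `a0OfP_pos`), FILE P1
`Node00.TorusCoverCubeMemberPrint` (`propCubeP`, `cornerP`, `sideP`, `sideP_le`, `le_sideP`, `boxWidth_propCubeP`), module 39 `cubeDomains`, k0-s2-w2's `prop6Printed_zdCubP_anti`,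
def-R's `suppDomOfRecord_eq`, lit-balaban p21's `RE` ∕ `dsE` ∕ `QpE`, `Domains`.  Filed `--kind proof --supports stmt-QuantumFields-27364` (K1⁹; count-neutral helper).
[15] = [Balaban1985Variational]; [6] = [Balaban1985RegularSpaces]; [B6] = [Balaban1984PropagatorsII]; [III] = [Balaban1988Convergent].

WHY (dag-n07-e g22 LOCATED-INWARD-DATUM + module 56 + CLAIM-57a, cell INBOX 2026-08-28).  The S6 head's per-datum token meets a datum through a point of the GRID CUBE
(`x ∈ cubeExt (side L Mc j) a 0` within 3 of a lift of `Ω_j`); dag-n07-e's level-raising reduction `datumGaugeSplitTopStepCoreG_of_clean` (print p. 300 «a cube □ intersecting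
Ω_j but not Ω_{j+1}») hands the head a CLEAN clause whose meeting premise is on the PRINT BOX: `∃ x ∈ box L (cornerP Mc ρ a) (sideP Mc ρ) j, ∃ y, π y ∈ Ω_j ∧ Within 3 x y`
(forced: the raised parent datum is met through a box point, not a grid-cube point).  Generation 6's door — the S3 call of the knit — takes the grid-cube witness and uses it
ONLY to derive the collar clause «`π(□̃) ⊆ Ω_{n−1}` (or the support of record at `n = 1`)» via dag-n07-w4's `Sect2.hcollar_cubeIdxP'_of_within_mem`; dag-n07-e's module 57a
proves the SAME collar clause, SAME floor `(11·d + 4ρ + M₀ + Dw)·L ≤ M₁`, from a BOX point.  THIS FILE is the token-pass: generation 6's theorem and proof with `hx : x ∈ box …`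
and the one collar line swapped.  §1 ★★★ `gauge152_REfiner153_box_of_within_box_of_prop6P_uniform`, ★ `…_of_one_le` (stub 2′'s bare `ρ₀ ≥ 1`, `ρ := ρ₀·L`).

HONEST FRAMING: count-neutral kernel-lane re-run of generation 6's bookkeeping with one hypothesis re-shaped (no new estimate, no new definition); [6] Proposition 6 on print's
class at the member is the HYPOTHESIS `hP6` (N05's node ∕ stub 2′'s body; never asserted here), applied once, to the CUBE datum; the non-wrapping of the datum's collared cube,
the floor, the radii and the box-form `Within`-witness are DISPLAYED; the kernel inclusion of clause 6 is a hypothesis of that clause; nothing of Bałaban discharged; tokens ∕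
stub 1 ∕ stub 2′ ∕ N07 ∕ N05 ∕ K0⁷ ∕ K1⁹ NOT closed; the cell's typed ∕ discharged counts are not moved by this file (the chair's tally of record is the only count); one finite 𝕋⁴
programme at fixed ε — R4 closes the conditional finite-𝕋⁴ rung `BalabanLadder.UV` only; the YM mass gap (Clay) is NOT proved by any of this; nothing continuum ∕ ℝ⁴ ∕
infinite volume ∕ OS.  No `sorry`, no `def`, no `instance`, no `notation`.
-/

noncomputable section

namespace Literature.MathematicalPhysics.QuantumFieldTheory.Balaban1983to89.Node00

open scoped Matrix.Norms.L2Operator InnerProductSpace RealInnerProductSpace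
open T4Continuum (T4Family)
open B15DeterminingSets B12RegularSpaces111
open B15Eq112TorusCover (cover)
open B14DomainGeom (Pt Within)
open B14.Eq213MaximalDomains (side cubeExt)
open B7Prop1Explicit (e)
open B8Eq131Cubes (box cube tcube bLo bHi)
open B8LeafModelZd (ZdIdx)
open B6SectADomainsV1 (Domains)
open B6SectAOperatorsV1 (RE dsE QpE)
open BalabanImbrieJaffe1984to88.BIJ85AxialPropagator411 (BondSpace)

variable {F : T4Family} {N : ℕ} [NeZero N]

/-! ## §1  ★★★ Every BOX-FORM datum meeting `Ω_n`, constants keyed on the grid-cube letter, the record's `M` free -/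

section UniformBox

/-- ★★★ **THE FAMILIES-LEVEL DOOR AT EVERY BOX-FORM DATUM MEETING `Ω_n`, UNIFORM IN THE RECORD'S BASIC CUBE SIZE** ([15] p. 300: *«Let us take a cube □ intersecting Ω_j but
not Ω_{j+1}»*, *«M is a multiple of R₁M₁»*; (144); p. 301 (150)–(153)).  Generation 6's `gauge152_REfiner153_box_of_within_of_prop6P_uniform` with the `Within`-witness `x` a point
of the PRINT BOX `box L (cornerP M₀ ρ a) (sideP M₀ ρ) n` within `Dw` of a lift `y` of a site of `Ω_n` (dag-n07-e's clean-clause premise) in place of a grid-cube point; every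
other binder — [6] Prop. 6 on print's class (the HYPOTHESIS `hP6`), `1 ≤ Mb`, the separated index `s`, the radii `0 < ε_m ≤ a0OfP F N Mb ρ B₁ c₁`, `ε_m ≤ 2ε_{m+1}`, the
(1.7)∕(1.9)-Top classes over `suppDomOfRecord`, `1 ≤ n ≤ k`, `n ≤ m + K`, `M₀ = Mb ∨ M₀ = L·Mb`, the floor `(11·4 + 4ρ + M₀ + Dw)·L ≤ ν.M₁`, the non-wrapping — and the whole
six-clause CONCLUSION (gauge equation and (152) letters `< b9OfP F Mb ρ B₁ · ε_n` on the window `π '' box L (cornerP M₀ ρ a) (sideP M₀ ρ) n`, `‖∂*∂A‖, ‖ΔA‖` on its deep bonds, (153)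
at every kernel-finer `D′`) VERBATIM.  Proof: generation 6's, the collar clause now by dag-n07-e's `Sect2.hcollar_cubeIdxP'_of_within_mem_box` (same floor).
[cite: Balaban1985Variational, (144) p.300, (150)–(153) p.301, p.302; Balaban1985RegularSpaces, Prop. 6 (1.135)–(1.138) p.99, p.98, (1.38) p.82; Balaban1984PropagatorsII, (2.7) p.224, (2.10)–(2.12) p.225; Balaban1988Convergent, p.255, (2.13) p.256] -/
theorem gauge152_REfiner153_box_of_within_box_of_prop6P_uniform {B₁ c₁ : ℝ} (hB₁ : 0 ≤ B₁) (hc₁ : 0 < c₁) {ρ : ℕ}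
    (hP6 : letI : CStarAlgebra (MatA N) := {}; B8.Prop6Printed 4 (F.L : ℝ) B₁ c₁ (fun i : ZdIdx 4 F.L => zdCubP (MatA N) F.L ρ i)) {Mb : ℕ} (hMb : 1 ≤ Mb)
    (ν : Stage7Numerics) {M : ℕ} (g : ℕ → ℝ) (K k : ℕ) (hρ : (F.P K).L ≤ ρ) (s : SeqOfRecord F ν M g K k) (hsep : Sect2.SeqSeparated ν.M₁ s)
    (ε : ℕ → ℝ)
    (hε : ∀ m, m ≤ k → 0 < ε m ∧ ε m ≤ a0OfP F N Mb ρ B₁ c₁) (hcomp : ∀ m, m < k → ε m ≤ 2 * ε (m + 1))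
    (U : GaugeField (F.P K) 0 (SU N))
    (h17 : ∀ m, m ≤ k → PlaqSmallOn (Sect2.omegaPlaqsTop s.Ω (suppDomOfRecord F ν K s.Ω) m) (ε m * (F.P K).eta m ^ 2) U)
    (h19 : ∀ m, m ≤ k → Sect2.CoDivSmallOn (Sect2.omegaBondsTop s.Ω (suppDomOfRecord F ν K s.Ω) m) (ε m * (F.P K).eta m ^ 3) U)
    {n : ℕ} (hn1 : 1 ≤ n) (hnk : n ≤ k) (hnK : n ≤ (F.P K).m + (F.P K).K) {M₀ : ℕ} (hM₀ : M₀ = Mb ∨ M₀ = F.L * Mb)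
    {Dw : ℕ} (hfloor : (11 * 4 + 4 * ρ + M₀ + Dw) * F.L ≤ ν.M₁) (a : Pt (F.P K).d) {x y : Pt (F.P K).d}
    (hx : x ∈ box (F.P K).L (cornerP (F.P K) M₀ ρ a) (sideP (F.P K) M₀ ρ) n) (hy : cover (F.P K) y ∈ s.Ω n) (hxy : Within (Dw : ℤ) x y)
    (hinj : Set.InjOn (cover (F.P K)) (cube (F.P K).L (cornerP (F.P K) M₀ ρ a) (sideP (F.P K) M₀ ρ) ρ n 0)) :
    ∃ u : GaugeTransf (F.P K) 0 (SU N), ∃ A : PBond (F.P K) 0 → MatA N,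
      (∀ b ∈ (Sect2.regionOfSet (F.P K) (cover (F.P K) '' box (F.P K).L (cornerP (F.P K) M₀ ρ a) (sideP (F.P K) M₀ ρ) n)).bonds,
          gaugeU (fun x => ιSU N (u x)) (fun b' => ιSU N (U b')) b = expI ((F.P K).eta n) (A b)) ∧
      (∀ b ∈ (Sect2.regionOfSet (F.P K) (cover (F.P K) '' box (F.P K).L (cornerP (F.P K) M₀ ρ a) (sideP (F.P K) M₀ ρ) n)).bonds,
          ‖A b‖ < b9OfP F Mb ρ B₁ * ε n) ∧
      (∀ q ∈ (Sect2.regionOfSet (F.P K) (cover (F.P K) '' box (F.P K).L (cornerP (F.P K) M₀ ρ a) (sideP (F.P K) M₀ ρ) n)).dpairs,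
          ‖grad ((F.P K).eta n) q.2.1 (fun y => A ⟨y, q.2.2⟩) q.1‖ < b9OfP F Mb ρ B₁ * ε n) ∧
      (∀ b ∈ Sect2.bondsDeep (cover (F.P K) '' box (F.P K).L (cornerP (F.P K) M₀ ρ a) (sideP (F.P K) M₀ ρ) n),
          ‖Sect2.codiffCurlA ((F.P K).eta n) A b.src b.dir‖ < b9OfP F Mb ρ B₁ * ε n) ∧
      (∀ b ∈ Sect2.bondsDeep (cover (F.P K) '' box (F.P K).L (cornerP (F.P K) M₀ ρ a) (sideP (F.P K) M₀ ρ) n),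
          ‖∑ ν' : Fin (F.P K).d, (((F.P K).eta n : ℝ) : ℂ)⁻¹ •
              (grad ((F.P K).eta n) ν' (fun y => A ⟨y, b.dir⟩) (b.src.unshift ν') - grad ((F.P K).eta n) ν' (fun y => A ⟨y, b.dir⟩) b.src)‖ <
            b9OfP F Mb ρ B₁ * ε n) ∧
      (∀ D' : Domains (F.P K),
        LinearMap.ker (QpE D') ≤ LinearMap.ker (QpE (cubeDomains (F.P K) (cornerP (F.P K) M₀ ρ a) (sideP (F.P K) M₀ ρ) ρ n hnK)) →
        ∀ φ : MatA N →L[ℂ] ℂ,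
          RE D' ((F.P K).eta n)⁻¹ (dsE ((F.P K).eta n)⁻¹ (WithLp.toLp 2 fun b => (φ (A b)).re : BondSpace (F.P K))) = 0 ∧
          RE D' ((F.P K).eta n)⁻¹ (dsE ((F.P K).eta n)⁻¹ (WithLp.toLp 2 fun b => (φ (A b)).im : BondSpace (F.P K))) = 0) := by
  letI : CStarAlgebra (MatA N) := {}
  have hL2 : 2 ≤ F.L := (F.P 0).hL.2
  have hd : 2 ≤ (F.P K).d := by rw [T4Family.P_d]; norm_num
  set M₂ : ℕ := F.L * Mb + 44 + 2 * ρ with hM₂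
  have ha₀ := a0OfP_pos (F := F) (N := N) Mb ρ hB₁ hc₁
  have hεn : 0 < ε n := (hε n hnk).1
  have hMpos : 0 < Mb := hMb
  -- the cube letter `M₀ ∈ {Mb, L·Mb}` is positive and `M₀ + 44 + 2ρ ≤ M₂` (generation 0's bookkeeping, the letter `Mb` in place of the record's `M`)
  have hM₀pos : 1 ≤ M₀ := by
    rcases hM₀ with h | h
    · rw [h]; exact hMpos
    · rw [h]; exact Nat.one_le_iff_ne_zero.2 (Nat.mul_ne_zero (F.P 0).L_pos.ne' hMpos.ne')
  have hM₀' : M₀ + 44 + 2 * ρ ≤ M₂ := by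
    rcases hM₀ with h | h
    · rw [h, hM₂]; nlinarith [(F.P 0).L_pos]
    · rw [h, hM₂]
  have hεn1 : 0 < ε (n - 1) := (hε (n - 1) (by omega)).1
  have hεn1a : ε (n - 1) ≤ a0OfP F N Mb ρ B₁ c₁ := (hε (n - 1) (by omega)).2
  have hε2 : ε (n - 1) ≤ 2 * ε n := by
    have := hcomp (n - 1) (by omega)
    rwa [show n - 1 + 1 = n by omega] at this
  -- the print side `M′ = sideP ≤ M₀ + 44 + 2ρ ≤ M₂`
  have hside : sideP (F.P K) M₀ ρ ≤ M₂ := by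
    have := sideP_le (P := F.P K) M₀ ρ
    rw [T4Family.P_d] at this
    omega
  have hM'r : ((sideP (F.P K) M₀ ρ : ℕ) : ℝ) ≤ (M₂ : ℝ) := by exact_mod_cast hside
  have hM'pos : (0 : ℝ) < ((sideP (F.P K) M₀ ρ : ℕ) : ℝ) := by
    have := le_sideP (P := F.P K) M₀ (lt_of_lt_of_le (F.P K).L_pos hρ)
    exact_mod_cast (show 0 < sideP (F.P K) M₀ ρ by omega)
  have hM₂pos : (0 : ℝ) < M₂ := lt_of_lt_of_le hM'pos hM'r
  -- the collar clause, FROM THE BOX-FORM `Within`-WITNESS (dag-n07-e's 57a `Sect2.hcollar_cubeIdxP'_of_within_mem_box`, by name) — the only place `s` enters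
  have hM₁ : 1 ≤ ν.M₁ := le_trans (Nat.one_le_iff_ne_zero.2 (Nat.mul_ne_zero (by omega) (by omega))) hfloor
  have hfloor' : (11 * (F.P K).d + 4 * ρ + M₀ + Dw) * (F.P K).L ≤ ν.M₁ := by rw [T4Family.P_d, T4Family.P_L]; exact hfloor
  have hcollar : cover (F.P K) '' (cubeIdxP' (F.P K) n hn1 M₀ ρ a).Ω 0 ⊆
      (if n - 1 = 0 then suppDomOfRecord F ν K s.Ω else s.Ω (n - 1)) := by
    rw [suppDomOfRecord_eq]
    exact Sect2.hcollar_cubeIdxP'_of_within_mem_box hM₁ s hsep hM₀pos hfloor' hn1 hnk hx hy hxy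
  -- the smallness «7dL²M′α₀ ≤ c₁»
  have ha₀c : a0OfP F N Mb ρ B₁ c₁ ≤ c₁ / (56 * (F.L : ℝ) ^ 5 * M₂) := by rw [hM₂]; exact min_le_left _ _
  have ha₀w : a0OfP F N Mb ρ B₁ c₁ ≤ 1 / (8 * (M₂ : ℝ) * N * (28 * (F.L : ℝ) ^ 5 * B₁ * M₂) + 1) := by rw [hM₂]; exact min_le_right _ _
  have hc₁' : 7 * (F.P K).d * ((F.P K).L : ℝ) ^ 2 * (propCubeP (F.P K) n hn1 M₀ ρ hρ a).M * (((F.P K).L : ℝ) ^ 3 * ε (n - 1)) ≤ c₁ := by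
    rw [propCubeP_M, T4Family.P_d, T4Family.P_L]
    have h1 : 7 * (4 : ℕ) * (F.L : ℝ) ^ 2 * ((sideP (F.P K) M₀ ρ : ℕ) : ℝ) * ((F.L : ℝ) ^ 3 * ε (n - 1)) ≤ 28 * (F.L : ℝ) ^ 5 * M₂ * a0OfP F N Mb ρ B₁ c₁ := by
      have : 7 * (4 : ℕ) * (F.L : ℝ) ^ 2 * ((sideP (F.P K) M₀ ρ : ℕ) : ℝ) * ((F.L : ℝ) ^ 3 * ε (n - 1)) =
          28 * (F.L : ℝ) ^ 5 * ((sideP (F.P K) M₀ ρ : ℕ) : ℝ) * ε (n - 1) := by push_cast; ring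
      rw [this]; gcongr
    have h2 : 28 * (F.L : ℝ) ^ 5 * M₂ * a0OfP F N Mb ρ B₁ c₁ ≤ 28 * (F.L : ℝ) ^ 5 * M₂ * (c₁ / (56 * (F.L : ℝ) ^ 5 * M₂)) :=
      mul_le_mul_of_nonneg_left ha₀c (by positivity)
    have h3 : 28 * (F.L : ℝ) ^ 5 * M₂ * (c₁ / (56 * (F.L : ℝ) ^ 5 * M₂)) = c₁ / 2 := by field_simp; ring
    linarith
  -- the `2π`-window of the normalisation
  have h2π : (2 * boxWidth (bLo (F.P K).L (propCubeP (F.P K) n hn1 M₀ ρ hρ a).a n 0)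
      (bHi (F.P K).L (propCubeP (F.P K) n hn1 M₀ ρ hρ a).a (propCubeP (F.P K) n hn1 M₀ ρ hρ a).M n 0) + 1) *
      ((F.P K).eta n * N * (7 * (F.P K).d * ((F.P K).L : ℝ) ^ 2 * B₁ * (propCubeP (F.P K) n hn1 M₀ ρ hρ a).M * (((F.P K).L : ℝ) ^ 3 * ε (n - 1)) *
        (((F.P K).L : ℝ) ^ n * (F.P K).eta n)⁻¹)) < 2 * Real.pi := by
    have hbw := boxWidth_propCubeP (F.P K) n hn1 M₀ ρ hρ a
    rw [propCubeP_k] at hbw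
    rw [hbw, propCubeP_M, B12Eq115BackgroundPair.pow_mul_eta, inv_one, mul_one, T4Family.P_d, T4Family.P_L]
    have hη : (F.L : ℝ) ^ n * (F.P K).eta n = 1 := by have := B12Eq115BackgroundPair.pow_mul_eta (F.P K) n; rwa [T4Family.P_L] at this
    have hηpos : 0 < (F.P K).eta n := B3GkZeroTorusRescaled.eta_pos (F.P K) n
    have hW : (2 * ((4 : ℕ) * ((F.L : ℝ) ^ n * ((sideP (F.P K) M₀ ρ : ℕ) : ℝ) - 1)) + 1) * (F.P K).eta n ≤ 8 * ((sideP (F.P K) M₀ ρ : ℕ) : ℝ) := by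
      have : (2 * ((4 : ℕ) * ((F.L : ℝ) ^ n * ((sideP (F.P K) M₀ ρ : ℕ) : ℝ) - 1)) + 1) * (F.P K).eta n =
          8 * ((sideP (F.P K) M₀ ρ : ℕ) : ℝ) * ((F.L : ℝ) ^ n * (F.P K).eta n) - 7 * (F.P K).eta n := by push_cast; ring
      rw [this, hη, mul_one]; linarith
    have hr : 7 * (4 : ℕ) * (F.L : ℝ) ^ 2 * B₁ * ((sideP (F.P K) M₀ ρ : ℕ) : ℝ) * ((F.L : ℝ) ^ 3 * ε (n - 1)) ≤ 28 * (F.L : ℝ) ^ 5 * B₁ * M₂ * a0OfP F N Mb ρ B₁ c₁ := by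
      have : 7 * (4 : ℕ) * (F.L : ℝ) ^ 2 * B₁ * ((sideP (F.P K) M₀ ρ : ℕ) : ℝ) * ((F.L : ℝ) ^ 3 * ε (n - 1)) =
          28 * (F.L : ℝ) ^ 5 * B₁ * ((sideP (F.P K) M₀ ρ : ℕ) : ℝ) * ε (n - 1) := by push_cast; ring
      rw [this]; gcongr
    set X : ℝ := 8 * (M₂ : ℝ) * N * (28 * (F.L : ℝ) ^ 5 * B₁ * M₂) with hX
    have hX0 : 0 ≤ X := by positivity
    have hXa : X * a0OfP F N Mb ρ B₁ c₁ < 1 := by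
      calc X * a0OfP F N Mb ρ B₁ c₁ ≤ X * (1 / (X + 1)) := mul_le_mul_of_nonneg_left ha₀w hX0
        _ < 1 := by rw [mul_one_div, div_lt_one (by positivity)]; linarith
    have hNr : (0 : ℝ) ≤ N := Nat.cast_nonneg N
    calc (2 * ((4 : ℕ) * ((F.L : ℝ) ^ n * ((sideP (F.P K) M₀ ρ : ℕ) : ℝ) - 1)) + 1) *
          ((F.P K).eta n * N * (7 * (4 : ℕ) * (F.L : ℝ) ^ 2 * B₁ * ((sideP (F.P K) M₀ ρ : ℕ) : ℝ) * ((F.L : ℝ) ^ 3 * ε (n - 1))))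
        = ((2 * ((4 : ℕ) * ((F.L : ℝ) ^ n * ((sideP (F.P K) M₀ ρ : ℕ) : ℝ) - 1)) + 1) * (F.P K).eta n) *
          (N * (7 * (4 : ℕ) * (F.L : ℝ) ^ 2 * B₁ * ((sideP (F.P K) M₀ ρ : ℕ) : ℝ) * ((F.L : ℝ) ^ 3 * ε (n - 1)))) := by ring
      _ ≤ (8 * ((sideP (F.P K) M₀ ρ : ℕ) : ℝ)) * (N * (28 * (F.L : ℝ) ^ 5 * B₁ * M₂ * a0OfP F N Mb ρ B₁ c₁)) := by
          gcongr
      _ ≤ (8 * (M₂ : ℝ)) * (N * (28 * (F.L : ℝ) ^ 5 * B₁ * M₂ * a0OfP F N Mb ρ B₁ c₁)) := by gcongr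
      _ = X * a0OfP F N Mb ρ B₁ c₁ := by rw [hX]; ring
      _ < 1 := hXa
      _ < 2 * Real.pi := by linarith [Real.pi_gt_three]
  -- the non-wrapping hypothesis in the datum's own letters (the projections of `propCubeP` are `rfl`)
  have hinj' : Set.InjOn (cover (F.P K))
      (cube (F.P K).L (propCubeP (F.P K) n hn1 M₀ ρ hρ a).a (propCubeP (F.P K) n hn1 M₀ ρ hρ a).M (propCubeP (F.P K) n hn1 M₀ ρ hρ a).ρ n 0) := hinj
  obtain ⟨u, A, h1, h2, h3, h4, h4', h5⟩ :=
    exists_localGauge152_REfiner153_coverBox_propCubeP_of_prop6P (P := F.P K) hd hB₁ (dvd_refl ρ) hρ hP6 U h17 h19 hn1 (by omega) hnK hεn1 a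
      hinj' hcollar hc₁' h2π
  -- the letters at `b9OfP F Mb ρ B₁ · ε_n`
  have hbound : 2 * (7 * (F.P K).d * ((F.P K).L : ℝ) ^ 2 * B₁ * (propCubeP (F.P K) n hn1 M₀ ρ hρ a).M * (((F.P K).L : ℝ) ^ 3 * ε (n - 1))) <
      b9OfP F Mb ρ B₁ * ε n := by
    rw [propCubeP_M, T4Family.P_d, T4Family.P_L, b9OfP]
    have : 2 * (7 * (4 : ℕ) * (F.L : ℝ) ^ 2 * B₁ * ((sideP (F.P K) M₀ ρ : ℕ) : ℝ) * ((F.L : ℝ) ^ 3 * ε (n - 1))) =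
        56 * (F.L : ℝ) ^ 5 * B₁ * ((sideP (F.P K) M₀ ρ : ℕ) : ℝ) * ε (n - 1) := by push_cast; ring
    rw [this]
    calc 56 * (F.L : ℝ) ^ 5 * B₁ * ((sideP (F.P K) M₀ ρ : ℕ) : ℝ) * ε (n - 1) ≤ 56 * (F.L : ℝ) ^ 5 * B₁ * M₂ * (2 * ε n) := by gcongr
      _ = (112 * (F.L : ℝ) ^ 5 * B₁ * M₂) * ε n := by ring
      _ < (112 * (F.L : ℝ) ^ 5 * B₁ * ((F.L * Mb + 44 + 2 * ρ : ℕ) : ℝ) + 1) * ε n := by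
          rw [hM₂]; exact mul_lt_mul_of_pos_right (lt_add_one _) hεn
  exact ⟨u, A, h1, fun b hb => (h2 b hb).trans_lt hbound, fun q hq => (h3 q hq).trans_lt hbound, fun b hb => (h4 b hb).trans_lt hbound,
    fun b hb => (h4' b hb).trans_lt hbound, h5⟩

/-- ★ **THE SAME AT STUB 2′'s BARE `ρ₀ ≥ 1`, BOX-FORM DATUM** (`ρ := ρ₀·L ≥ L`, by `prop6Printed_zdCubP_anti`; floor `(11·4 + 4·(ρ₀L) + M₀ + Dw)·L`, constants
`b9OfP F Mb (ρ₀L) B₁`, `a0OfP F N Mb (ρ₀L) B₁ c₁` on the cube letter `Mb`, the record's `M` free).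
[cite: Balaban1985Variational, (144) p.300, (150)–(153) p.301; Balaban1985RegularSpaces, Prop. 6 p.99, p.98 («M is a multiple of R₁M₁»); Balaban1984PropagatorsII, (2.12) p.225] -/
theorem gauge152_REfiner153_box_of_within_box_of_prop6P_uniform_of_one_le {B₁ c₁ : ℝ} (hB₁ : 0 ≤ B₁) (hc₁ : 0 < c₁) {ρ₀ : ℕ} (hρ₀ : 1 ≤ ρ₀)
    (hP6 : letI : CStarAlgebra (MatA N) := {}; B8.Prop6Printed 4 (F.L : ℝ) B₁ c₁ (fun i : ZdIdx 4 F.L => zdCubP (MatA N) F.L ρ₀ i)) {Mb : ℕ} (hMb : 1 ≤ Mb)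
    (ν : Stage7Numerics) {M : ℕ} (g : ℕ → ℝ) (K k : ℕ) (s : SeqOfRecord F ν M g K k) (hsep : Sect2.SeqSeparated ν.M₁ s)
    (ε : ℕ → ℝ)
    (hε : ∀ m, m ≤ k → 0 < ε m ∧ ε m ≤ a0OfP F N Mb (ρ₀ * F.L) B₁ c₁) (hcomp : ∀ m, m < k → ε m ≤ 2 * ε (m + 1))
    (U : GaugeField (F.P K) 0 (SU N))
    (h17 : ∀ m, m ≤ k → PlaqSmallOn (Sect2.omegaPlaqsTop s.Ω (suppDomOfRecord F ν K s.Ω) m) (ε m * (F.P K).eta m ^ 2) U)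
    (h19 : ∀ m, m ≤ k → Sect2.CoDivSmallOn (Sect2.omegaBondsTop s.Ω (suppDomOfRecord F ν K s.Ω) m) (ε m * (F.P K).eta m ^ 3) U)
    {n : ℕ} (hn1 : 1 ≤ n) (hnk : n ≤ k) (hnK : n ≤ (F.P K).m + (F.P K).K) {M₀ : ℕ} (hM₀ : M₀ = Mb ∨ M₀ = F.L * Mb)
    {Dw : ℕ} (hfloor : (11 * 4 + 4 * (ρ₀ * F.L) + M₀ + Dw) * F.L ≤ ν.M₁) (a : Pt (F.P K).d) {x y : Pt (F.P K).d}
    (hx : x ∈ box (F.P K).L (cornerP (F.P K) M₀ (ρ₀ * F.L) a) (sideP (F.P K) M₀ (ρ₀ * F.L)) n) (hy : cover (F.P K) y ∈ s.Ω n) (hxy : Within (Dw : ℤ) x y)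
    (hinj : Set.InjOn (cover (F.P K)) (cube (F.P K).L (cornerP (F.P K) M₀ (ρ₀ * F.L) a) (sideP (F.P K) M₀ (ρ₀ * F.L)) (ρ₀ * F.L) n 0)) :
    ∃ u : GaugeTransf (F.P K) 0 (SU N), ∃ A : PBond (F.P K) 0 → MatA N,
      (∀ b ∈ (Sect2.regionOfSet (F.P K) (cover (F.P K) '' box (F.P K).L (cornerP (F.P K) M₀ (ρ₀ * F.L) a) (sideP (F.P K) M₀ (ρ₀ * F.L)) n)).bonds,
          gaugeU (fun x => ιSU N (u x)) (fun b' => ιSU N (U b')) b = expI ((F.P K).eta n) (A b)) ∧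
      (∀ b ∈ (Sect2.regionOfSet (F.P K) (cover (F.P K) '' box (F.P K).L (cornerP (F.P K) M₀ (ρ₀ * F.L) a) (sideP (F.P K) M₀ (ρ₀ * F.L)) n)).bonds,
          ‖A b‖ < b9OfP F Mb (ρ₀ * F.L) B₁ * ε n) ∧
      (∀ q ∈ (Sect2.regionOfSet (F.P K) (cover (F.P K) '' box (F.P K).L (cornerP (F.P K) M₀ (ρ₀ * F.L) a) (sideP (F.P K) M₀ (ρ₀ * F.L)) n)).dpairs,
          ‖grad ((F.P K).eta n) q.2.1 (fun y => A ⟨y, q.2.2⟩) q.1‖ < b9OfP F Mb (ρ₀ * F.L) B₁ * ε n) ∧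
      (∀ b ∈ Sect2.bondsDeep (cover (F.P K) '' box (F.P K).L (cornerP (F.P K) M₀ (ρ₀ * F.L) a) (sideP (F.P K) M₀ (ρ₀ * F.L)) n),
          ‖Sect2.codiffCurlA ((F.P K).eta n) A b.src b.dir‖ < b9OfP F Mb (ρ₀ * F.L) B₁ * ε n) ∧
      (∀ b ∈ Sect2.bondsDeep (cover (F.P K) '' box (F.P K).L (cornerP (F.P K) M₀ (ρ₀ * F.L) a) (sideP (F.P K) M₀ (ρ₀ * F.L)) n),
          ‖∑ ν' : Fin (F.P K).d, (((F.P K).eta n : ℝ) : ℂ)⁻¹ •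
              (grad ((F.P K).eta n) ν' (fun y => A ⟨y, b.dir⟩) (b.src.unshift ν') - grad ((F.P K).eta n) ν' (fun y => A ⟨y, b.dir⟩) b.src)‖ <
            b9OfP F Mb (ρ₀ * F.L) B₁ * ε n) ∧
      (∀ D' : Domains (F.P K),
        LinearMap.ker (QpE D') ≤
            LinearMap.ker (QpE (cubeDomains (F.P K) (cornerP (F.P K) M₀ (ρ₀ * F.L) a) (sideP (F.P K) M₀ (ρ₀ * F.L)) (ρ₀ * F.L) n hnK)) →
        ∀ φ : MatA N →L[ℂ] ℂ,
          RE D' ((F.P K).eta n)⁻¹ (dsE ((F.P K).eta n)⁻¹ (WithLp.toLp 2 fun b => (φ (A b)).re : BondSpace (F.P K))) = 0 ∧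
          RE D' ((F.P K).eta n)⁻¹ (dsE ((F.P K).eta n)⁻¹ (WithLp.toLp 2 fun b => (φ (A b)).im : BondSpace (F.P K))) = 0) := by
  letI : CStarAlgebra (MatA N) := {}
  exact gauge152_REfiner153_box_of_within_box_of_prop6P_uniform hB₁ hc₁ (prop6Printed_zdCubP_anti (fun i : ZdIdx 4 F.L => i) (Dvd.intro F.L rfl) hP6) hMb ν g K k
    (Nat.le_mul_of_pos_left F.L hρ₀) s hsep ε hε hcomp U h17 h19 hn1 hnk hnK hM₀ hfloor a hx hy hxy hinj

end UniformBox

end Literature.MathematicalPhysics.QuantumFieldTheory.Balaban1983to89.Node00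

end
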